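/-
Copyright: cell `pub-ymgap` (HUMAN RULING D-0062), Track A of `YM-PLAN.md`, DAG node N20 (= NE7b); R134 seat `pub-ymgap-dag-n20-d`
(strategy s3 «alternative currency», generation 5), module 2 of 2.  Released under the licence of the surrounding project.
-/
import Summits.QuantumFields.YangMills.Theorems.BalabanUVNodesN20ByValueTelescoping
import Summits.QuantumFields.YangMills.Theorems.BalabanUVNodesN20LCSPushforward

/-!
# YM-DAG node N20 (= NE7b), strategy s3, THE FOURTH CURRENCY «BY VALUE» (module 2 of 2): on a module tower the K-step per-class display of the
# (α) road (`PinnedExtraction.ExtractionLaws.extract` ∕ `PrefixExtraction.sum_admS_integral_le_mul_sum_adm`) follows from — and, for exact pins,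
# is EQUIVALENT to — ONE UNCONDITIONAL joint-sparseness inequality under the level-0 state `ρ₀ dμ_0` (no floor, no envelope, no conditional
# moment in the term's own state); NODE 00's T-step of record IS a module step (junction through n20-c's push-forward identity)

Track A of `YM-PLAN.md` (cell `pub-ymgap`, HUMAN RULING D-0062), node **N20** = spine estimate NE7b (`T4WeightBudget.RelWeightBound` — the cell
`pub-balaban`'s OWN estimate, NOT PRINTED in [Bałaban 1983–89], NOT PROVED).  Seat `pub-ymgap-dag-n20-d` (R134, s3), generation 5, module 2
(module 1 = `…N20ByValueTelescoping`: `pullAlong` over the tree's `ShellMeasureAverageIterate.iterMap`, by-value telescoping `integral_mul_eterm_eq_pullAlong`, `sum_admS_integral_eterm_eq`,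
`sum_adm_integral_eterm_eq`).  Kernel theorems only: 0 `def`, 0 `sorry`, standard axioms; COUNT-NEUTRAL (`--supports` K3‴ `SpineGivenEndpointR13`,
stmt-QuantumFields-19912, `--as helper`).  Restate-immune (no Theses import, no ∃-currency module).

WHY A FOURTH CURRENCY (located, honest; this seat's reading of the tree for dag-lead's currency column).  NE7b's output shape is reached in the
tree by THREE typed currencies meeting ONE wall: (P1) the re-cut (α) road — per pinned class a RELATIVE K-step partial-sum display
`Σ_{class} A ≤ q·Σ_T A` (`PinnedExtraction.ExtractionLaws`), derived by PREFIX INDUCTION from ONE-STEP relative displays `hrel`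
(`PrefixExtraction.sum_admS_integral_le_mul_sum_adm`), themselves from POINTWISE EXTRACTION + LOCAL CONDITIONAL STABILITY «LCS-j» IN THE HISTORY
TERM'S OWN STATE (`LocalConditionalStability.hrel_of_LCS`) — a CONDITIONAL exponential moment per pinned step, print's KIND
([Balaban1989LargeFieldI] (0.3)–(0.5) p. 176–177), not print's statement; (P2) context-uniform TERM RATIOS (`T4HistoryPeeling.SlotDom` …; this
lineage's generation 0 `…N20RenewalCurrency`); (GD) ABSOLUTE numerator over the (2.50) floor AT THE PARTIAL SUM (`T4GlobalDenominator`,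
`ExtractionLaws.ofAbsolute`; dead TERMWISE by the owner's F-ne7bp1-g103-1∕2: free dead labels `≍ L^{4K}` against quasi-polynomial birth factors,
bare-field entropy in the floor).  On a MODULE tower (module 1's `hmod`) the SAME display needs neither conditioning nor a floor:
* (C) per-step PINNED-SUM LETTERS `Σ_{p ∈ branch ∩ S} χ_{j,g,p} ≤ e_j` (pointwise on `C j`; `e_j = 1` at an unpinned step by the decomposition of
  unity, `e_j =` the pinned event's indicator — or its Chebyshev majorant `e^{−a}·e^{δQ}`, `LocalConditionalStability.chebyshev_extraction` — at a
  pinned one) give `Σ_{admS K} ∫ eterm dμ_K ≤ ∫ (Π_{j<K} e_j ∘ iterMap j)·ρ₀ dμ_0` (`sum_admS_integral_le_integral_prod`), so the RELATIVE display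
  with quotient `q` follows from the ONE inequality
    (JS) `∫ (Π_{j<K} e_j(iterMap j y))·ρ₀(y) dμ_0 ≤ q·∫ ρ₀ dμ_0`   (`sum_admS_integral_le_mul_sum_adm_byValue`)
  — the JOINT SPARSENESS of the pinned events of ALL pinned levels, read on the level-0 field through the iterated level maps, under the
  level-0 state `ρ₀ dμ_0`;
* (D) for EXACT pins the class sum IS `∫ (Π e_j ∘ iterMap j)·ρ₀ dμ_0` (`sum_admS_integral_eq_integral_prod`), so the display with quotient `q`
  holds IF AND ONLY IF (JS) does (`sum_admS_integral_le_mul_iff`): (JS) is THE content of the display, not a device for it;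
* (E) THE COST–VOLUME INEQUALITY BY VALUE (`sum_admS_integral_le_of_jointMoment`, twin of `LocalConditionalStability.sum_admS_integral_le_of_LCS`):
  with print's Chebyshev letters `e_j = e^{−δ_jθ_j}·e^{δ_jQ_j}` at the pinned levels `J` (`chebyshev_extraction`) the quotient is
  `exp Σ_{j∈J}(b_j − δ_jθ_j)` from ONE joint multiscale exponential moment (JM) `∫ (Π_{j∈J} e^{δ_jQ_j ∘ iterMap j})·ρ₀ dμ_0 ≤ e^{Σ_{j∈J} b_j}·∫ρ₀ dμ_0`
  — where the (α) road asks one CONDITIONAL moment `≤ e^{b_j}` per pinned step in the term's own state.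
So in this currency the per-class residual of NE7b is ONE multiscale large-deviation bound for ITERATED BLOCK AVERAGES of the level-0 field under
`ρ₀ dμ_0` — objects the tree HOLDS at the record (`YM4dLatticeSUN.gibbsMeasure`, `BlockAveraging.avgFun`, `Averaging.iter (Node00.avOfRecord …)`).
With pins at the FIRST step only, (JS) is a one-level Peierls bound of the kind already in the tree (this lineage's
`…N20LCSAvgExpMoment.gibbsMeasure_largeField_avgFun_le`; n20-c's `…N20LCSLargeFieldFirstStep.abs_integral_pinnedLargeLabels_rhoZero_le`, whose
first-step displays ARE (C) at `K = 1` at the record).  For pins at SEVERAL levels (a renewal chain), (JS) is print's KIND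
([Balaban1989LargeFieldII] (1.79) p. 383: one small factor per large-field region of every scale) and NOT print's statement; and it does NOT
follow from single-level exponential moments by Hölder (with `n` pinned events Hölder divides the Chebyshev parameter `δ` by `n`, so the total
gain stays `δ₀·p₀`, not `n·δ₀·p₀` — the renewal count is lost): located here, not claimed, for the planner.  (JS) and «LCS-j» are the two
faces of one wall: conditional per step (tower form) versus joint and unconditional at level 0 (by value).
* §2 JUNCTION `hmod_of_kernelTransport`: on bounded-measurable levels (`bddMeas`), a tower whose admissible operations ACT AS
  `f ↦ kernelTransport (μ j) (μ (j+1)) (avg j) (χ_{j,g,p}·f)` along measurable level maps with `(μ j).map (avg j) ≪ μ (j+1)` HAS the module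
  property — by n20-c's `N20LCSPushforward.integral_mul_kernelTransport`; NODE 00's T-step of record has that form (their §1:
  `Node00.TStepOfRecord.texpASucc = transportK …`), so a pure-𝐓 tower of record is a module tower once typed as a `Tower`.

HONEST FRAMING.  Count-neutral kernel bookkeeping [folklore] (Bochner monotonicity + module 1); which towers are Bałaban's and whether their
𝐑-terms are module steps is (A1c) DATA (NC-NE7b-α UNRULED) — displayed as `hmod`, not touched; (JS) for pins at several levels is NOT in the tree
and NOT printed as a statement; nothing of Bałaban's is asserted, valued or instantiated; NE7b NOT PRINTED ∕ NOT PROVED; the (α)-instance 0∕1;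
N20 NOT discharged (typed 28∕28, discharged count untouched); one finite four-torus programme at fixed `ε` — NOT ℝ⁴, NOT infinite volume, NOT OS,
NOT a mass gap, NOT Clay.  References (LOCATORS only; no decl carries a cite tag): T. Bałaban, CMP **122** (1989) 175–202 [Balaban1989LargeFieldI]
((0.3)–(0.5), (0.4) p. 176); CMP **122** (1989) 355–392 [Balaban1989LargeFieldII] ((1.79) p. 383); [Balaban1988Convergent] CMP **119** (1988) (2.50) p. 264.
-/

set_option autoImplicit false

noncomputable section

open Finset MeasureTheory
open Summit.QuantumFields.BalabanUV.T4Continuum.B16HistoryIndexedRepr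
open Summit.QuantumFields.BalabanUV.T4Continuum.B16HistoryReprChain
open Summit.QuantumFields.BalabanUV.T4Continuum.NE7b.PrefixExtraction
  (admS mem_admS_succ admS_subset_adm sum_admS_succ admS_eq_adm_of_forall eterm_snoc)
open Literature.MathematicalPhysics.QuantumFieldTheory.Balaban1983to89.T4AveragingDisintegration (kernelTransport)
open Summit.QuantumFields.YangMills.BalabanUVNodes.N20LCSPushforward (integral_mul_kernelTransport)
open Summit.QuantumFields.BalabanUV.T4Continuum.NE7b.LocalConditionalStability (chebyshev_extraction)

open Summit.QuantumFields.BalabanUV.T4Continuum.ShellMeasureAverageIterate (iterMap iterMap_zero iterMap_succ)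
open Summit.QuantumFields.YangMills.BalabanUVNodes.N20ByValueTelescoping

namespace Summit.QuantumFields.YangMills.BalabanUVNodes.N20ByValueExtraction

variable {P : Type} [DecidableEq P] {C : ℕ → Type} {𝒢 : (j : ℕ) → GoodClass (C j)}

/-! ## §1 The per-class display FROM ONE joint-sparseness inequality under the level-0 state — and the converse for exact pins -/

section Display

variable (T : Tower P C 𝒢) [∀ j, MeasurableSpace (C j)] (μ : (j : ℕ) → Measure (C j))
  (avg : (j : ℕ) → C j → C (j + 1)) (χ : (j : ℕ) → (Fin j → P) → P → C j → ℝ)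
  (S : (j : ℕ) → (Fin j → P) → Finset P) (e : (j : ℕ) → C j → ℝ)

omit [∀ j, MeasurableSpace (C j)] in
/-- **PINNED-SUM LETTERS BOUND THE CLASS'S PULL-BACK BY A PRODUCT.**  Non-negative characteristic functions and, at every level `j < K` after
every pattern prefix `g`, the pointwise letter `Σ_{p ∈ branch j g ∩ S j g} χ_{j,g,p} ≤ e_j` on `C j` (with `e_j ≥ 0`; `e_j = 1` at an unpinned step
by the decomposition of unity, the pinned event's indicator or its Chebyshev majorant at a pinned one) give
`Σ_{h ∈ admS K} pullAlong K h y ≤ Π_{j<K} e_j(iterMap j y)` for every level-0 configuration `y`. [folklore] -/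
theorem sum_admS_pullAlong_le_prod (hχ0 : ∀ j g p y, 0 ≤ χ j g p y) (he : ∀ j y, 0 ≤ e j y) :
    ∀ K : ℕ, (∀ (j : ℕ) (g : Fin j → P), j < K → g ∈ admS T S j → ∀ y, ∑ p ∈ T.branch j g ∩ S j g, χ j g p y ≤ e j y) →
      ∀ y : C 0, ∑ h ∈ admS T S K, pullAlong avg χ K h y ≤ ∏ j ∈ Finset.range K, e j (iterMap avg j y)
  | 0, _, y => by
      show ∑ h ∈ (Finset.univ : Finset (Fin 0 → P)), pullAlong avg χ 0 h y ≤ _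
      rw [Finset.univ_unique, Finset.sum_singleton, pullAlong_zero, Finset.prod_range_zero]
  | K + 1, hpin, y => by
      rw [sum_admS_succ, Finset.prod_range_succ]
      calc ∑ g ∈ admS T S K, ∑ p ∈ T.branch K g ∩ S K g, pullAlong avg χ (K + 1) (Fin.snoc g p) y
          = ∑ g ∈ admS T S K, pullAlong avg χ K g y * ∑ p ∈ T.branch K g ∩ S K g, χ K g p (iterMap avg K y) := by
            refine Finset.sum_congr rfl fun g _ => ?_
            rw [Finset.mul_sum]
            exact Finset.sum_congr rfl fun p _ => pullAlong_snoc avg χ K g p y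
        _ ≤ ∑ g ∈ admS T S K, pullAlong avg χ K g y * e K (iterMap avg K y) :=
            Finset.sum_le_sum fun g hg =>
              mul_le_mul_of_nonneg_left (hpin K g K.lt_succ_self hg _) (pullAlong_nonneg avg χ hχ0 K g y)
        _ = (∑ g ∈ admS T S K, pullAlong avg χ K g y) * e K (iterMap avg K y) := (Finset.sum_mul _ _ _).symm
        _ ≤ (∏ j ∈ Finset.range K, e j (iterMap avg j y)) * e K (iterMap avg K y) :=
            mul_le_mul_of_nonneg_right
              (sum_admS_pullAlong_le_prod hχ0 he K (fun j g hj => hpin j g (Nat.lt_succ_of_lt hj)) y) (he K _)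

omit [∀ j, MeasurableSpace (C j)] in
/-- **EXACT PINS GIVE THE PRODUCT EXACTLY**: if at every level `j < K` after every pattern prefix the pinned characteristic functions SUM TO
`e_j` (in particular `e_j = 1` at unpinned steps), then `Σ_{h ∈ admS K} pullAlong K h y = Π_{j<K} e_j(iterMap j y)`. [folklore] -/
theorem sum_admS_pullAlong_eq_prod :
    ∀ K : ℕ, (∀ (j : ℕ) (g : Fin j → P), j < K → g ∈ admS T S j → ∀ y, ∑ p ∈ T.branch j g ∩ S j g, χ j g p y = e j y) →
      ∀ y : C 0, ∑ h ∈ admS T S K, pullAlong avg χ K h y = ∏ j ∈ Finset.range K, e j (iterMap avg j y)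
  | 0, _, y => by
      show ∑ h ∈ (Finset.univ : Finset (Fin 0 → P)), pullAlong avg χ 0 h y = _
      rw [Finset.univ_unique, Finset.sum_singleton, pullAlong_zero, Finset.prod_range_zero]
  | K + 1, hpin, y => by
      rw [sum_admS_succ, Finset.prod_range_succ]
      calc ∑ g ∈ admS T S K, ∑ p ∈ T.branch K g ∩ S K g, pullAlong avg χ (K + 1) (Fin.snoc g p) y
          = ∑ g ∈ admS T S K, pullAlong avg χ K g y * ∑ p ∈ T.branch K g ∩ S K g, χ K g p (iterMap avg K y) := by
            refine Finset.sum_congr rfl fun g _ => ?_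
            rw [Finset.mul_sum]
            exact Finset.sum_congr rfl fun p _ => pullAlong_snoc avg χ K g p y
        _ = ∑ g ∈ admS T S K, pullAlong avg χ K g y * e K (iterMap avg K y) :=
            Finset.sum_congr rfl fun g hg => by rw [hpin K g K.lt_succ_self hg]
        _ = (∑ g ∈ admS T S K, pullAlong avg χ K g y) * e K (iterMap avg K y) := (Finset.sum_mul _ _ _).symm
        _ = (∏ j ∈ Finset.range K, e j (iterMap avg j y)) * e K (iterMap avg K y) := by
            rw [sum_admS_pullAlong_eq_prod K (fun j g hj => hpin j g (Nat.lt_succ_of_lt hj)) y]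

/-- **THE CLASS WEIGHT UNDER THE JOINT PULL-BACK OF ITS PINNED EVENTS.**  Module property + pinned-sum letters + `ρ₀ ≥ 0` ⟹
`Σ_{h ∈ admS K} ∫ eterm K h dμ_K ≤ ∫ (Π_{j<K} e_j(iterMap j y))·ρ₀(y) dμ_0` — the pattern class's level-`K` weight is at most the level-0
integral of `ρ₀` against the PRODUCT OF THE PINNED LETTERS OF ALL PINNED LEVELS read through the iterated level maps: no floor, no envelope,
no moment in the term's own state. [folklore] -/
theorem sum_admS_integral_le_integral_prod
    (havg : ∀ (j : ℕ) (m : C (j + 1) → ℝ), (𝒢 (j + 1)).Gd m → (𝒢 j).Gd (fun y => m (avg j y)))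
    (hχ : ∀ j g p, (𝒢 j).Gd (χ j g p)) (hχ0 : ∀ j g p y, 0 ≤ χ j g p y)
    (hmod : ∀ (j : ℕ) (g : Fin j → P) (p : P), g ∈ T.adm j → p ∈ T.branch j g → ∀ (m : C (j + 1) → ℝ) (f : C j → ℝ),
      (𝒢 (j + 1)).Gd m → (𝒢 j).Gd f →
        ∫ x, m x * (T.op j g p).T f x ∂μ (j + 1) = ∫ y, m (avg j y) * (χ j g p y * f y) ∂μ j)
    {ρ₀ : C 0 → ℝ} (hρ : (𝒢 0).Gd ρ₀) (h0 : ∀ y, 0 ≤ ρ₀ y) (hint0 : ∀ f : C 0 → ℝ, (𝒢 0).Gd f → Integrable f (μ 0))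
    (he : ∀ j y, 0 ≤ e j y) (heg : ∀ j, (𝒢 j).Gd (e j)) (K : ℕ)
    (hpin : ∀ (j : ℕ) (g : Fin j → P), j < K → g ∈ admS T S j → ∀ y, ∑ p ∈ T.branch j g ∩ S j g, χ j g p y ≤ e j y) :
    ∑ h ∈ admS T S K, ∫ x, T.eterm ρ₀ K h x ∂μ K ≤ ∫ y, (∏ j ∈ Finset.range K, e j (iterMap avg j y)) * ρ₀ y ∂μ 0 := by
  rw [sum_admS_integral_eterm_eq T μ avg χ S havg hχ hmod hρ hint0 K]
  refine integral_mono ?_ ?_ fun y => mul_le_mul_of_nonneg_right (sum_admS_pullAlong_le_prod T avg χ S e hχ0 he K hpin y) (h0 y)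
  · exact hint0 _ ((𝒢 0).mul ((𝒢 0).sum _ _ fun h _ => pullAlong_good havg hχ K h) hρ)
  · exact hint0 _ ((𝒢 0).mul (good_prod_iterMap havg heg K) hρ)

/-- **THE (α) ROAD's PER-CLASS DISPLAY FROM ONE JOINT-SPARSENESS INEQUALITY (the fourth currency).**  On a module tower with the decomposition
of unity, pinned-sum letters `e_j` at the pattern's levels and the ONE level-0 inequality
  (JS) `∫ (Π_{j<K} e_j(iterMap j y))·ρ₀(y) dμ_0 ≤ q·∫ ρ₀ dμ_0`
give the RELATIVE K-step partial-sum display of `PrefixExtraction.sum_admS_integral_le_mul_sum_adm` ∕ `PinnedExtraction.ExtractionLaws.extract`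
with quotient `q`:  `Σ_{h ∈ admS K} ∫ eterm K h dμ_K ≤ q·Σ_{h ∈ adm K} ∫ eterm K h dμ_K`.  In this currency the per-class residual of NE7b is
(JS) — the joint sparseness of the pinned events of ALL pinned levels under the level-0 state — and nothing conditional. [folklore] -/
theorem sum_admS_integral_le_mul_sum_adm_byValue
    (havg : ∀ (j : ℕ) (m : C (j + 1) → ℝ), (𝒢 (j + 1)).Gd m → (𝒢 j).Gd (fun y => m (avg j y)))
    (hχ : ∀ j g p, (𝒢 j).Gd (χ j g p)) (hχ0 : ∀ j g p y, 0 ≤ χ j g p y)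
    (hmod : ∀ (j : ℕ) (g : Fin j → P) (p : P), g ∈ T.adm j → p ∈ T.branch j g → ∀ (m : C (j + 1) → ℝ) (f : C j → ℝ),
      (𝒢 (j + 1)).Gd m → (𝒢 j).Gd f →
        ∫ x, m x * (T.op j g p).T f x ∂μ (j + 1) = ∫ y, m (avg j y) * (χ j g p y * f y) ∂μ j)
    (hunit : ∀ (j : ℕ) (g : Fin j → P), g ∈ T.adm j → ∀ y, ∑ p ∈ T.branch j g, χ j g p y = 1)
    {ρ₀ : C 0 → ℝ} (hρ : (𝒢 0).Gd ρ₀) (h0 : ∀ y, 0 ≤ ρ₀ y) (hint0 : ∀ f : C 0 → ℝ, (𝒢 0).Gd f → Integrable f (μ 0))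
    (he : ∀ j y, 0 ≤ e j y) (heg : ∀ j, (𝒢 j).Gd (e j)) (K : ℕ)
    (hpin : ∀ (j : ℕ) (g : Fin j → P), j < K → g ∈ admS T S j → ∀ y, ∑ p ∈ T.branch j g ∩ S j g, χ j g p y ≤ e j y)
    {q : ℝ} (hJS : ∫ y, (∏ j ∈ Finset.range K, e j (iterMap avg j y)) * ρ₀ y ∂μ 0 ≤ q * ∫ y, ρ₀ y ∂μ 0) :
    ∑ h ∈ admS T S K, ∫ x, T.eterm ρ₀ K h x ∂μ K ≤ q * ∑ h ∈ T.adm K, ∫ x, T.eterm ρ₀ K h x ∂μ K := by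
  rw [sum_adm_integral_eterm_eq T μ avg χ havg hχ hmod hρ hint0 hunit K]
  exact (sum_admS_integral_le_integral_prod T μ avg χ S e havg hχ hχ0 hmod hρ h0 hint0 he heg K hpin).trans hJS

/-- **EXACT PINS: THE CLASS WEIGHT IS THE JOINT PULL-BACK INTEGRAL.**  If the pinned characteristic functions sum EXACTLY to the letters `e_j`
(and to `1 = e_j` at unpinned steps), then `Σ_{h ∈ admS K} ∫ eterm K h dμ_K = ∫ (Π_{j<K} e_j(iterMap j y))·ρ₀(y) dμ_0`. [folklore] -/
theorem sum_admS_integral_eq_integral_prod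
    (havg : ∀ (j : ℕ) (m : C (j + 1) → ℝ), (𝒢 (j + 1)).Gd m → (𝒢 j).Gd (fun y => m (avg j y)))
    (hχ : ∀ j g p, (𝒢 j).Gd (χ j g p))
    (hmod : ∀ (j : ℕ) (g : Fin j → P) (p : P), g ∈ T.adm j → p ∈ T.branch j g → ∀ (m : C (j + 1) → ℝ) (f : C j → ℝ),
      (𝒢 (j + 1)).Gd m → (𝒢 j).Gd f →
        ∫ x, m x * (T.op j g p).T f x ∂μ (j + 1) = ∫ y, m (avg j y) * (χ j g p y * f y) ∂μ j)
    {ρ₀ : C 0 → ℝ} (hρ : (𝒢 0).Gd ρ₀) (hint0 : ∀ f : C 0 → ℝ, (𝒢 0).Gd f → Integrable f (μ 0)) (K : ℕ)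
    (hexact : ∀ (j : ℕ) (g : Fin j → P), j < K → g ∈ admS T S j → ∀ y, ∑ p ∈ T.branch j g ∩ S j g, χ j g p y = e j y) :
    ∑ h ∈ admS T S K, ∫ x, T.eterm ρ₀ K h x ∂μ K = ∫ y, (∏ j ∈ Finset.range K, e j (iterMap avg j y)) * ρ₀ y ∂μ 0 := by
  rw [sum_admS_integral_eterm_eq T μ avg χ S havg hχ hmod hρ hint0 K]
  refine integral_congr_ae (Filter.Eventually.of_forall fun y => ?_)
  show (∑ h ∈ admS T S K, pullAlong avg χ K h y) * ρ₀ y = (∏ j ∈ Finset.range K, e j (iterMap avg j y)) * ρ₀ y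
  rw [sum_admS_pullAlong_eq_prod T avg χ S e K hexact y]

/-- **THE DISPLAY WITH QUOTIENT `q` ⟺ (JS), for exact pins.**  On a module tower with the decomposition of unity and exact pinned sums, the
relative K-step per-class display with quotient `q` holds IF AND ONLY IF the joint-sparseness inequality (JS) with the same `q` holds: in the
fourth currency (JS) is not a sufficient device but THE content of the display. [folklore] -/
theorem sum_admS_integral_le_mul_iff
    (havg : ∀ (j : ℕ) (m : C (j + 1) → ℝ), (𝒢 (j + 1)).Gd m → (𝒢 j).Gd (fun y => m (avg j y)))
    (hχ : ∀ j g p, (𝒢 j).Gd (χ j g p))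
    (hmod : ∀ (j : ℕ) (g : Fin j → P) (p : P), g ∈ T.adm j → p ∈ T.branch j g → ∀ (m : C (j + 1) → ℝ) (f : C j → ℝ),
      (𝒢 (j + 1)).Gd m → (𝒢 j).Gd f →
        ∫ x, m x * (T.op j g p).T f x ∂μ (j + 1) = ∫ y, m (avg j y) * (χ j g p y * f y) ∂μ j)
    (hunit : ∀ (j : ℕ) (g : Fin j → P), g ∈ T.adm j → ∀ y, ∑ p ∈ T.branch j g, χ j g p y = 1)
    {ρ₀ : C 0 → ℝ} (hρ : (𝒢 0).Gd ρ₀) (hint0 : ∀ f : C 0 → ℝ, (𝒢 0).Gd f → Integrable f (μ 0)) (K : ℕ)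
    (hexact : ∀ (j : ℕ) (g : Fin j → P), j < K → g ∈ admS T S j → ∀ y, ∑ p ∈ T.branch j g ∩ S j g, χ j g p y = e j y)
    (q : ℝ) :
    ∑ h ∈ admS T S K, ∫ x, T.eterm ρ₀ K h x ∂μ K ≤ q * ∑ h ∈ T.adm K, ∫ x, T.eterm ρ₀ K h x ∂μ K ↔
      ∫ y, (∏ j ∈ Finset.range K, e j (iterMap avg j y)) * ρ₀ y ∂μ 0 ≤ q * ∫ y, ρ₀ y ∂μ 0 := by
  rw [sum_adm_integral_eterm_eq T μ avg χ havg hχ hmod hρ hint0 hunit K,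
    sum_admS_integral_eq_integral_prod T μ avg χ S e havg hχ hmod hρ hint0 K hexact]


/-- **THE COST–VOLUME INEQUALITY BY VALUE** (the by-value twin of `LocalConditionalStability.sum_admS_integral_le_of_LCS`).  Pin the levels of
`J`: at a pinned level `j < K`, after every pattern prefix, let the pinned characteristic functions form a sub-partition of unity
(`Σ_{branch ∩ S} χ ≤ 1`) supported where a level-`j` functional is large (`χ_{j,g,p} y ≠ 0 ⇒ θ_j ≤ Q_j y` — the pinned EVENT), and leave the other
levels free (`branch ⊆ S`, decomposition of unity).  Then print's Chebyshev split (`LocalConditionalStability.chebyshev_extraction`, letters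
`e_j = e^{−δ_jθ_j}·e^{δ_jQ_j}`) and §1 give the class display with quotient `exp Σ_{j ∈ J, j<K} (b_j − δ_jθ_j)` from the ONE level-0 inequality
  (JM) `∫ (Π_{j ∈ J, j<K} e^{δ_j Q_j(iterMap j y)})·ρ₀(y) dμ_0 ≤ e^{Σ_{j ∈ J, j<K} b_j}·∫ ρ₀ dμ_0`
— the JOINT MULTISCALE EXPONENTIAL MOMENT of the sacrificed functionals of ALL pinned levels, each read on the level-0 field through the iterated
level maps, under the level-0 state: «extracted cost `Σ δ_jθ_j` against joint volume `Σ b_j`».  On the (α) road the same quotient needs one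
CONDITIONAL moment `≤ e^{b_j}` per pinned step in the term's own state (`LocCondStability`); by value it needs (JM) once, unconditionally. [folklore] -/
theorem sum_admS_integral_le_of_jointMoment (J : Finset ℕ) (θ δ b : ℕ → ℝ) (Q : (j : ℕ) → C j → ℝ) (hδ : ∀ j, 0 ≤ δ j)
    (havg : ∀ (j : ℕ) (m : C (j + 1) → ℝ), (𝒢 (j + 1)).Gd m → (𝒢 j).Gd (fun y => m (avg j y)))
    (hχ : ∀ j g p, (𝒢 j).Gd (χ j g p)) (hχ0 : ∀ j g p y, 0 ≤ χ j g p y)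
    (hmod : ∀ (j : ℕ) (g : Fin j → P) (p : P), g ∈ T.adm j → p ∈ T.branch j g → ∀ (m : C (j + 1) → ℝ) (f : C j → ℝ),
      (𝒢 (j + 1)).Gd m → (𝒢 j).Gd f →
        ∫ x, m x * (T.op j g p).T f x ∂μ (j + 1) = ∫ y, m (avg j y) * (χ j g p y * f y) ∂μ j)
    (hunit : ∀ (j : ℕ) (g : Fin j → P), g ∈ T.adm j → ∀ y, ∑ p ∈ T.branch j g, χ j g p y = 1)
    {ρ₀ : C 0 → ℝ} (hρ : (𝒢 0).Gd ρ₀) (h0 : ∀ y, 0 ≤ ρ₀ y) (hint0 : ∀ f : C 0 → ℝ, (𝒢 0).Gd f → Integrable f (μ 0))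
    (hQg : ∀ j, (𝒢 j).Gd fun y => Real.exp (δ j * Q j y)) (K : ℕ)
    (hχ1 : ∀ (j : ℕ) (g : Fin j → P), j < K → j ∈ J → g ∈ admS T S j → ∀ y, ∑ p ∈ T.branch j g ∩ S j g, χ j g p y ≤ 1)
    (hsupp : ∀ (j : ℕ) (g : Fin j → P), j < K → j ∈ J → g ∈ admS T S j →
      ∀ p ∈ T.branch j g ∩ S j g, ∀ y, χ j g p y ≠ 0 → θ j ≤ Q j y)
    (hfree : ∀ (j : ℕ) (g : Fin j → P), j < K → j ∉ J → T.branch j g ⊆ S j g)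
    (hJM : ∫ y, (∏ j ∈ (Finset.range K).filter (· ∈ J), Real.exp (δ j * Q j (iterMap avg j y))) * ρ₀ y ∂μ 0 ≤
      Real.exp (∑ j ∈ (Finset.range K).filter (· ∈ J), b j) * ∫ y, ρ₀ y ∂μ 0) :
    ∑ h ∈ admS T S K, ∫ x, T.eterm ρ₀ K h x ∂μ K ≤
      Real.exp (∑ j ∈ (Finset.range K).filter (· ∈ J), (b j - δ j * θ j)) * ∑ h ∈ T.adm K, ∫ x, T.eterm ρ₀ K h x ∂μ K := by
  -- the letters: Chebyshev at the pinned levels, `1` at the free ones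
  let e : (j : ℕ) → C j → ℝ := fun j y => if j ∈ J then Real.exp (-(δ j * θ j)) * Real.exp (δ j * Q j y) else 1
  have he : ∀ j y, 0 ≤ e j y := fun j y => by
    by_cases hj : j ∈ J
    · simp only [e, if_pos hj]; positivity
    · simp only [e, if_neg hj]; exact zero_le_one
  have heg : ∀ j, (𝒢 j).Gd (e j) := fun j => by
    by_cases hj : j ∈ J
    · simpa only [e, if_pos hj] using (𝒢 j).smul (Real.exp (-(δ j * θ j))) (hQg j)
    · simpa only [e, if_neg hj] using (𝒢 j).const 1
  have hpin : ∀ (j : ℕ) (g : Fin j → P), j < K → g ∈ admS T S j → ∀ y, ∑ p ∈ T.branch j g ∩ S j g, χ j g p y ≤ e j y := by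
    intro j g hj hg y
    by_cases hJ : j ∈ J
    · simp only [e, if_pos hJ]
      exact chebyshev_extraction (T.branch j g ∩ S j g) (fun p => χ j g p) (Q j) (hδ j) (hχ1 j g hj hJ hg)
        (fun p hp y' => hsupp j g hj hJ hg p hp y') y
    · simp only [e, if_neg hJ]
      rw [Finset.inter_eq_left.2 (hfree j g hj hJ), hunit j g (admS_subset_adm T S j hg) y]
  -- the product of the letters along the levels: extracted costs times the joint moment's integrand
  have hprod : ∀ y, ∏ j ∈ Finset.range K, e j (iterMap avg j y) =
      Real.exp (-(∑ j ∈ (Finset.range K).filter (· ∈ J), δ j * θ j)) *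
        ∏ j ∈ (Finset.range K).filter (· ∈ J), Real.exp (δ j * Q j (iterMap avg j y)) := by
    intro y
    simp only [e]
    rw [Finset.prod_ite, Finset.prod_const_one, mul_one, Finset.prod_mul_distrib, ← Finset.sum_neg_distrib, Real.exp_sum]
  have hJS : ∫ y, (∏ j ∈ Finset.range K, e j (iterMap avg j y)) * ρ₀ y ∂μ 0 ≤
      Real.exp (∑ j ∈ (Finset.range K).filter (· ∈ J), (b j - δ j * θ j)) * ∫ y, ρ₀ y ∂μ 0 := by
    simp_rw [hprod, mul_assoc]
    rw [integral_const_mul]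
    calc Real.exp (-(∑ j ∈ (Finset.range K).filter (· ∈ J), δ j * θ j)) *
          ∫ y, (∏ j ∈ (Finset.range K).filter (· ∈ J), Real.exp (δ j * Q j (iterMap avg j y))) * ρ₀ y ∂μ 0
        ≤ Real.exp (-(∑ j ∈ (Finset.range K).filter (· ∈ J), δ j * θ j)) *
            (Real.exp (∑ j ∈ (Finset.range K).filter (· ∈ J), b j) * ∫ y, ρ₀ y ∂μ 0) :=
          mul_le_mul_of_nonneg_left hJM (Real.exp_pos _).le
      _ = Real.exp (∑ j ∈ (Finset.range K).filter (· ∈ J), (b j - δ j * θ j)) * ∫ y, ρ₀ y ∂μ 0 := by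
          rw [← mul_assoc, ← Real.exp_add, Finset.sum_sub_distrib]
          ring_nf
  exact sum_admS_integral_le_mul_sum_adm_byValue T μ avg χ S e havg hχ hχ0 hmod hunit hρ h0 hint0 he heg K hpin hJS

end Display

/-! ## §2 Junction: towers whose operations act as the disintegration transport of the level maps HAVE the module property -/

section Junction

variable {X : ℕ → Type} [∀ j, MeasurableSpace (X j)] [∀ j, StandardBorelSpace (X j)] [∀ j, Nonempty (X j)]
  (T : Tower P X fun j => bddMeas (X j)) (μ : (j : ℕ) → Measure (X j)) [∀ j, IsFiniteMeasure (μ j)]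
  (avg : (j : ℕ) → X j → X (j + 1)) (χ : (j : ℕ) → (Fin j → P) → P → X j → ℝ)

omit [DecidableEq P] in
/-- **THE T-STEP OF RECORD IS A MODULE STEP.**  On bounded-measurable levels, if every admissible one-step operation ACTS on good functions AS
the disintegration transport of the choice's characteristic function times the argument along a measurable level map with absolutely
continuous image measure — `(op j g p).T f = kernelTransport (μ j) (μ (j+1)) (avg j) (χ_{j,g,p}·f)` (NODE 00's T-step of record has this form:
n20-c's `N20LCSPushforward` §1, `Node00.TStepOfRecord.texpASucc = transportK …`) — then the tower has the module property `hmod` of §2, by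
n20-c's `integral_mul_kernelTransport`. [folklore] -/
theorem hmod_of_kernelTransport (havgm : ∀ j, Measurable (avg j)) (hac : ∀ j, (μ j).map (avg j) ≪ μ (j + 1))
    (hχ : ∀ j g p, (bddMeas (X j)).Gd (χ j g p))
    (hop : ∀ (j : ℕ) (g : Fin j → P) (p : P), g ∈ T.adm j → p ∈ T.branch j g → ∀ f : X j → ℝ, (bddMeas (X j)).Gd f →
      (T.op j g p).T f = kernelTransport (μ j) (μ (j + 1)) (avg j) (fun y => χ j g p y * f y)) :
    ∀ (j : ℕ) (g : Fin j → P) (p : P), g ∈ T.adm j → p ∈ T.branch j g → ∀ (m : X (j + 1) → ℝ) (f : X j → ℝ),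
      (bddMeas (X (j + 1))).Gd m → (bddMeas (X j)).Gd f →
        ∫ x, m x * (T.op j g p).T f x ∂μ (j + 1) = ∫ y, m (avg j y) * (χ j g p y * f y) ∂μ j := by
  intro j g p hg hp m f hm hf
  obtain ⟨hmm, B, hB⟩ := hm
  rw [hop j g p hg hp f hf]
  exact integral_mul_kernelTransport (μ j) (μ (j + 1)) (havgm j) (hac j)
    (integrable_of_bddMeas (μ j) ((bddMeas (X j)).mul (hχ j g p) hf)) hmm hB

end Junction

end Summit.QuantumFields.YangMills.BalabanUVNodes.N20ByValueExtraction
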